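import Summits.Ventures.HSemireg.UntwistComplexLeibnizData
import Literature.AlgebraicGeometry.HodgeTheory.HodgeSheafWedgeAlternating
import Literature.AlgebraicGeometry.Modules.CechThetaVanishing
import HarnessLib

/-!
# Venture HSemireg — route R1.0, complex carriers: the JET-LEVEL wedge cocycle
# (gs-g4 gen 22, brick C6b of `general-structure/COMPLEX-LEIBNIZ-PLAN-gs-g4.md`; data for centrality)

HONEST FRAMING. Module-level homological algebra on the tree's REAL carriers: th-4's `Ωʲ`-twisted jet module
`Pʲ(E) = twistJetModule E j` (pairs `(φ, ψ)`, `φ ∈ E ⊗ Ωʲ`, `ψ ∈ E ⊗ Ωʲ⁺¹`, twisted action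
`a · (φ, ψ) = (a φ, a ψ + da ∧ φ)`), gs-g4's local post-composition `postcompOver` / `wedgeHomAt`, the `dlog` form
`ω_{xy} = dlogForm c x y` of a unit cocycle `c`, and the local `1`-cocycles of `CocycleExtension(Complex)`.
Nothing about any variety; nothing here says HC, HC_CM or HC_AV is proved.

## What is constructed / proved (`namespace Summit.Ventures.HSemireg.CocycleTwist`)

* `jetWedgeHom E j α : Pʲ(E)|_V ⟶ Pʲ⁺¹(E)|_V` for a `1`-form `α ∈ Γ(Ω¹, V)`: `(φ, ψ) ↦ (φ ≫ ((-α) ∧ –), ψ ≫ (α ∧ –))`.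
  It is `𝒪`-LINEAR for the twisted structures precisely because `1`-forms anticommute
  (`da ∧ (α ∧ s) = -α ∧ (da ∧ s)`, th-4's `wedgeForm_comp_wedgeForm_comm`) — whence the opposite signs on the two
  components. Values, additivity in `α`, restriction, and the three compatibilities:
  `ι_j| ≫ jetWedgeHom α = (ψ ↦ ψ ≫ (α ∧ –)) ≫ ι_{j+1}|`, `jetWedgeHom α ≫ π_{j+1}| = π_j| ≫ (φ ↦ φ ≫ ((-α) ∧ –))`,
  and naturality in `E` (`Pʲ(g)` is pre-composition, the wedge is post-composition).
* `jetWedgeCocycle c E j : LocalOneCocycle c (Pʲ E) (Pʲ⁺¹ E)` (`α = ω_{xy} = dlog g_{xy}`) and its complex version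
  `jetWedgeCocycleC c j L : LocalOneCocycleC c (Pʲ L) (Pʲ⁺¹ L)` (commutes with `Pʲ(d)`).
* `LocalOneCocycle.neg` / `LocalOneCocycleC.neg` (the opposite cocycle) and the compatibilities needed to place
  `extC (jetWedgeCocycleC)` as the MIDDLE COLUMN of the `3 × 3` diagram whose rows are the twisted Atiyah sequences
  `S_{j+1}(L)`, `S_j(L)` and whose outer columns are the `dlog`-wedge cocycle extensions (`dlogWedgeCocycleC`, the
  class `ν`): `ι•` intertwines `-(dlogWedgeCocycleC (j+1))` with the jet cocycle, `π•` intertwines the jet cocycle with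
  `dlogWedgeCocycleC j` (sequel `AtiyahNuCommute`).

## References

* M. F. Atiyah, *Complex analytic connections in fibre bundles*, Trans. AMS 85 (1957), §4, Prop. 12. [Atiyah1957]
* R.-O. Buchweitz, H. Flenner, Compositio Math. 137 (2003), §3 (Atiyah class of complexes; graded centrality
  Prop. 3.12). [BuchweitzFlenner2003]
-/

noncomputable section

set_option backward.isDefEq.respectTransparency false

open CategoryTheory CategoryTheory.Limits AlgebraicGeometry Opposite TopologicalSpace

namespace Summit.Ventures.HSemireg

namespace CocycleTwist

open Literature.AlgebraicGeometry.Modules Literature.AlgebraicGeometry.Motives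
  Literature.AlgebraicGeometry.HodgeTheory Summit.HodgeConjecture.HodgeConjecture.Theorems.PadicPridhamSemiregularity

universe u

variable {S : Type u} [CommRing S] {X : Over (Spec (CommRingCat.of S))} (E : X.left.Modules) (j : ℕ)

/-! ### `1`-forms anticommute (gs-g4 spelling `wedgeHomAt = wedgeForm`) -/

/-- **`(θ ∧ –) ≫ (θ' ∧ –) = -((θ' ∧ –) ≫ (θ ∧ –))`** on `Ωʲ|_V` (th-4's `wedgeForm_comp_wedgeForm_comm`, restated for
gs-g4's definitionally equal `wedgeHomAt`). [cite: Kodaira2005, §3.1 (b)] -/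
theorem wedgeHomAt_comp_wedgeHomAt_comm {V : X.left.Opens} (θ θ' : Γ(cotangentSheaf X, V)) :
    wedgeHomAt j θ ≫ wedgeHomAt (j + 1) θ' = -(wedgeHomAt j θ' ≫ wedgeHomAt (j + 1) θ) :=
  wedgeForm_comp_wedgeForm_comm θ θ'

/-- Restriction of `1`-forms is transitive (the form needed below). [folklore] -/
theorem cotangent_map_map {V W W' : X.left.Opens} (k : W ⟶ V) (l : W' ⟶ W) (α : Γ(cotangentSheaf X, V)) :
    (cotangentSheaf X).presheaf.map l.op ((cotangentSheaf X).presheaf.map k.op α) =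
      (cotangentSheaf X).presheaf.map (l ≫ k).op α := by
  rw [op_comp, (cotangentSheaf X).presheaf.map_comp]; rfl

/-! ### The jet-level wedge map `(φ, ψ) ↦ (φ ≫ ((-α) ∧ –), ψ ≫ (α ∧ –))` -/

section JetWedge

variable {V : X.left.Opens} (α : Γ(cotangentSheaf X, V))

/-- On twisted jet sections over `W ≤ V`: `(φ, ψ) ↦ (φ ≫ ((-α|_W) ∧ –), ψ ≫ (α|_W ∧ –))`. [folklore] -/
def jetWedgeFun {W : X.left.Opens} (k : W ⟶ V) (p : TwistJetSections E j W) : TwistJetSections E (j + 1) W :=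
  TwistJetSections.mk (p.fst ≫ wedgeHomAt j (-((cotangentSheaf X).presheaf.map k.op α)))
    (p.snd ≫ wedgeHomAt (j + 1) ((cotangentSheaf X).presheaf.map k.op α))

/-- First component of `jetWedgeFun`. [folklore] -/
@[simp]
theorem fst_jetWedgeFun {W : X.left.Opens} (k : W ⟶ V) (p : TwistJetSections E j W) :
    (jetWedgeFun E j α k p).fst = p.fst ≫ wedgeHomAt j (-((cotangentSheaf X).presheaf.map k.op α)) := rfl

/-- Second component of `jetWedgeFun`. [folklore] -/
@[simp]
theorem snd_jetWedgeFun {W : X.left.Opens} (k : W ⟶ V) (p : TwistJetSections E j W) :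
    (jetWedgeFun E j α k p).snd = p.snd ≫ wedgeHomAt (j + 1) ((cotangentSheaf X).presheaf.map k.op α) := rfl

/-- `jetWedgeFun` is additive. [folklore] -/
theorem jetWedgeFun_add {W : X.left.Opens} (k : W ⟶ V) (p q : TwistJetSections E j W) :
    jetWedgeFun E j α k (p + q) = jetWedgeFun E j α k p + jetWedgeFun E j α k q :=
  TwistJetSections.ext (by simp [Preadditive.add_comp]) (by simp [Preadditive.add_comp])

/-- `jetWedgeFun 0 = 0`. [folklore] -/
theorem jetWedgeFun_zero {W : X.left.Opens} (k : W ⟶ V) : jetWedgeFun E j α k (0 : TwistJetSections E j W) = 0 :=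
  TwistJetSections.ext (by simp) (by simp)

/-- **`jetWedgeFun` is `𝒪(W)`-linear for the TWISTED structures** — the anticommutation of `1`-forms at work:
`(a ψ + da ∧ φ) ≫ (α ∧ –) = a (ψ ≫ (α ∧ –)) + da ∧ (φ ≫ ((-α) ∧ –))`. [cite: Kodaira2005, §3.1 (b)] -/
theorem jetWedgeFun_smul {W : X.left.Opens} (k : W ⟶ V) (r : Γ(X.left, W)) (p : TwistJetSections E j W) :
    jetWedgeFun E j α k (r • p) = r • jetWedgeFun E j α k p := by
  refine TwistJetSections.ext ?_ ?_
  · rw [fst_jetWedgeFun, TwistJetSections.fst_smul, TwistJetSections.fst_smul, fst_jetWedgeFun, smul_comp_overHom]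
  · rw [snd_jetWedgeFun, TwistJetSections.snd_smul, TwistJetSections.snd_smul, snd_jetWedgeFun, fst_jetWedgeFun,
      wedgeD_eq_comp_wedgeHomAt, wedgeD_eq_comp_wedgeHomAt, Preadditive.add_comp, smul_comp_overHom, Category.assoc,
      Category.assoc, wedgeHomAt_comp_wedgeHomAt_comm, wedgeHomAt_neg, Preadditive.neg_comp]

/-- `jetWedgeFun` is compatible with restriction. [folklore] -/
theorem jetWedgeFun_restrict {W W' : X.left.Opens} (k : W ⟶ V) (l : W' ⟶ W) (p : TwistJetSections E j W) :
    jetWedgeFun E j α (l ≫ k) (TwistJetSections.restrict l p) = TwistJetSections.restrict l (jetWedgeFun E j α k p) := by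
  refine TwistJetSections.ext ?_ ?_
  · rw [fst_jetWedgeFun, TwistJetSections.fst_restrict, TwistJetSections.fst_restrict, fst_jetWedgeFun,
      restrictHom_comp, restrictHom_wedgeHomAt, map_neg, cotangent_map_map]
  · rw [snd_jetWedgeFun, TwistJetSections.snd_restrict, TwistJetSections.snd_restrict, snd_jetWedgeFun,
      restrictHom_comp, restrictHom_wedgeHomAt, cotangent_map_map]

/-- **`jetWedgeHom E j α : Pʲ(E)|_V ⟶ Pʲ⁺¹(E)|_V`**, `(φ, ψ) ↦ (φ ≫ ((-α) ∧ –), ψ ≫ (α ∧ –))`. [folklore] -/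
def jetWedgeHom : (twistJetModule E j).over V ⟶ (twistJetModule E (j + 1)).over V :=
  overHomMk
    (fun W k =>
      { toFun := fun p => (jetWedgeFun E j α k (p : TwistJetSections E j W) : TwistJetSections E (j + 1) W)
        map_zero' := jetWedgeFun_zero E j α k
        map_add' := fun p q => jetWedgeFun_add E j α k p q })
    (fun W k r p => jetWedgeFun_smul E j α k r p)
    (fun W W' k k' l p => by
      change jetWedgeFun E j α k' (TwistJetSections.restrict l p) = TwistJetSections.restrict l (jetWedgeFun E j α k p)
      rw [Subsingleton.elim k' (l ≫ k)]
      exact jetWedgeFun_restrict E j α k l p)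

/-- Values of `jetWedgeHom`. [folklore] -/
@[simp]
theorem appLE_jetWedgeHom {W : X.left.Opens} (k : W ⟶ V) (p : TwistJetSections E j W) :
    appLE (jetWedgeHom E j α) k (p : Γ(twistJetModule E j, W)) = (jetWedgeFun E j α k p : Γ(twistJetModule E (j + 1), W)) :=
  rfl

/-- `jetWedgeHom` is additive in the form. [folklore] -/
theorem jetWedgeHom_add (β : Γ(cotangentSheaf X, V)) :
    jetWedgeHom E j (α + β) = jetWedgeHom E j α + jetWedgeHom E j β :=
  hom_ext_of_appLE fun W k (p : TwistJetSections E j W) => by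
    rw [appLE_add, appLE_jetWedgeHom, appLE_jetWedgeHom, appLE_jetWedgeHom]
    change jetWedgeFun E j (α + β) k p = jetWedgeFun E j α k p + jetWedgeFun E j β k p
    refine TwistJetSections.ext ?_ ?_
    · rw [fst_jetWedgeFun, TwistJetSections.fst_add, fst_jetWedgeFun, fst_jetWedgeFun, map_add, neg_add,
        wedgeHomAt_add, Preadditive.comp_add]
    · rw [snd_jetWedgeFun, TwistJetSections.snd_add, snd_jetWedgeFun, snd_jetWedgeFun, map_add, wedgeHomAt_add,
        Preadditive.comp_add]

/-- `jetWedgeHom α` restricts to `jetWedgeHom (α|)`. [folklore] -/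
theorem restrictHom_jetWedgeHom {V' : X.left.Opens} (i : V' ⟶ V) :
    restrictHom i (jetWedgeHom E j α) = jetWedgeHom E j ((cotangentSheaf X).presheaf.map i.op α) :=
  hom_ext_of_appLE fun W k (p : TwistJetSections E j W) => by
    rw [appLE_restrictHom, appLE_jetWedgeHom, appLE_jetWedgeHom]
    change jetWedgeFun E j α (k ≫ i) p = jetWedgeFun E j _ k p
    refine TwistJetSections.ext ?_ ?_
    · rw [fst_jetWedgeFun, fst_jetWedgeFun, cotangent_map_map]
    · rw [snd_jetWedgeFun, snd_jetWedgeFun, cotangent_map_map]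

/-- **`ι_j| ≫ jetWedgeHom α = (ψ ↦ ψ ≫ (α ∧ –)) ≫ ι_{j+1}|`**: on the sub `E ⊗ Ωʲ⁺¹` the jet cocycle is `+α ∧ –`.
[folklore] -/
theorem over_map_twistJetι_comp_jetWedgeHom :
    (SheafOfModules.overFunctor _ V).map (twistJetι E j) ≫ jetWedgeHom E j α =
      postcompOver (dual E) (wedgeHomAt (j + 1) α) ≫ (SheafOfModules.overFunctor _ V).map (twistJetι E (j + 1)) :=
  hom_ext_of_appLE fun W k (ψ : (dual E).over W ⟶ (hodgeSheaf X (j + 1)).over W) => by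
    rw [appLE_comp, appLE_over_map, twistJetι_app_apply, appLE_jetWedgeHom, appLE_comp, appLE_postcompOver,
      appLE_over_map, twistJetι_app_apply, restrictHom_wedgeHomAt]
    exact congrArg (fun q : TwistJetSections E (j + 1) W => (q : Γ(twistJetModule E (j + 1), W)))
      (TwistJetSections.ext (by rw [fst_jetWedgeFun]; exact zero_comp) rfl)

/-- **`jetWedgeHom α ≫ π_{j+1}| = π_j| ≫ (φ ↦ φ ≫ ((-α) ∧ –))`**: on the quotient `E ⊗ Ωʲ` the jet cocycle is
`(-α) ∧ –`. [folklore] -/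
theorem jetWedgeHom_comp_over_map_twistJetπ :
    jetWedgeHom E j α ≫ (SheafOfModules.overFunctor _ V).map (twistJetπ E (j + 1)) =
      (SheafOfModules.overFunctor _ V).map (twistJetπ E j) ≫ postcompOver (dual E) (wedgeHomAt j (-α)) :=
  hom_ext_of_appLE fun W k (p : TwistJetSections E j W) => by
    rw [appLE_comp, appLE_jetWedgeHom, appLE_over_map, twistJetπ_app_apply, fst_jetWedgeFun, appLE_comp,
      appLE_over_map, twistJetπ_app_apply, appLE_postcompOver, restrictHom_wedgeHomAt, map_neg]

variable {E} in
/-- **Naturality in `E`**: `Pʲ(g)| ≫ jetWedgeHom_{E'} α = jetWedgeHom_E α ≫ Pʲ⁺¹(g)|` (`Pʲ(g)` pre-composes with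
`g^∨`, the wedge post-composes). [folklore] -/
theorem over_map_twistJetMap_comp_jetWedgeHom {E' : X.left.Modules} (g : E ⟶ E') :
    (SheafOfModules.overFunctor _ V).map (twistJetMap g j) ≫ jetWedgeHom E' j α =
      jetWedgeHom E j α ≫ (SheafOfModules.overFunctor _ V).map (twistJetMap g (j + 1)) :=
  hom_ext_of_appLE fun W k (p : TwistJetSections E j W) => by
    rw [appLE_comp, appLE_over_map, twistJetMap_app_apply, appLE_jetWedgeHom, appLE_comp, appLE_jetWedgeHom,
      appLE_over_map, twistJetMap_app_apply]
    exact congrArg (fun q : TwistJetSections E' (j + 1) W => (q : Γ(twistJetModule E' (j + 1), W)))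
      (TwistJetSections.ext (Category.assoc _ _ _) (Category.assoc _ _ _))

end JetWedge

/-! ### The jet-level wedge cocycle `α = ω_{xy} = dlog g_{xy}` -/

section Cocycle

variable (c : UnitCocycle X.left)

/-- **The jet-level `dlog`-wedge cocycle** `w^P_{xy} : Pʲ(E)| ⟶ Pʲ⁺¹(E)|`, `(φ, ψ) ↦ (φ ≫ ((-ω_{xy}) ∧ –),
ψ ≫ (ω_{xy} ∧ –))`, `ω_{xy} = dlogForm c x y`. [cite: Atiyah1957, Prop. 12] -/
def jetWedgeCocycle : LocalOneCocycle c (twistJetModule E j) (twistJetModule E (j + 1)) where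
  w x y V hx hy := jetWedgeHom E j (dlogForm c x y V hx hy)
  restrictHom_w x y V W hx hy i := by rw [restrictHom_jetWedgeHom, map_dlogForm]
  w_cocycle x y z V hx hy hz := by rw [dlogForm_add c x y z V hx hy hz, jetWedgeHom_add]

/-- Components of the jet-level cocycle. [folklore] -/
@[simp]
theorem jetWedgeCocycle_w (x y : X.left) (V : X.left.Opens) (hx : V ≤ c.U x) (hy : V ≤ c.U y) :
    (jetWedgeCocycle E j c).w x y V hx hy = jetWedgeHom E j (dlogForm c x y V hx hy) := rfl

variable (L : CochainComplex X.left.Modules ℤ)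

/-- **The jet-level `dlog`-wedge cocycle of a complex** `L`: degreewise `jetWedgeCocycle (Lⁱ)`; it commutes with the
differentials `Pʲ(d)` by naturality in `E`. [cite: Atiyah1957, Prop. 12] -/
def jetWedgeCocycleC : LocalOneCocycleC c (twistJetComplex X j L) (twistJetComplex X (j + 1) L) where
  w i := jetWedgeCocycle (L.X i) j c
  comm i i' x y V hx hy := by
    rw [jetWedgeCocycle_w, jetWedgeCocycle_w, twistJetComplex_d, twistJetComplex_d]
    exact over_map_twistJetMap_comp_jetWedgeHom j _ (L.d i i')

/-- Components of the jet-level cocycle of a complex. [folklore] -/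
@[simp]
theorem jetWedgeCocycleC_w (i : ℤ) : (jetWedgeCocycleC j c L).w i = jetWedgeCocycle (L.X i) j c := rfl

end Cocycle

end CocycleTwist

/-! ### The opposite cocycle -/

namespace LocalOneCocycle

open Literature.AlgebraicGeometry.Modules CocycleTwist

universe u'

variable {X : Scheme.{u'}} {c : UnitCocycle X} {A B : X.Modules} (w : LocalOneCocycle c A B)

/-- **The opposite cocycle `-w`.** [folklore] -/
def neg : LocalOneCocycle c A B where
  w x y V hx hy := -w.w x y V hx hy
  restrictHom_w x y V W hx hy i := by
    rw [show restrictHom i (-w.w x y V hx hy) = -restrictHom i (w.w x y V hx hy) from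
        hom_ext_of_appLE fun _ _ _ => rfl, w.restrictHom_w]
  w_cocycle x y z V hx hy hz := by rw [w.w_cocycle x y z V hx hy hz, neg_add]

/-- Components of the opposite cocycle. [folklore] -/
@[simp]
theorem neg_w (x y : X) (V : X.Opens) (hx : V ≤ c.U x) (hy : V ≤ c.U y) :
    w.neg.w x y V hx hy = -w.w x y V hx hy := rfl

/-- Restriction to an open of a negated morphism. [folklore] -/
theorem over_map_neg {E M : X.Modules} (V : X.Opens) (f : E ⟶ M) :
    (SheafOfModules.overFunctor _ V).map (-f) = -(SheafOfModules.overFunctor _ V).map f :=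
  hom_ext_of_appLE fun _ _ _ => rfl

/-- `(𝟙, -𝟙)` intertwines `w` and `-w` (the hypothesis of `CocycleExtension.map`). [folklore] -/
theorem compat_neg (x y : X) (V : X.Opens) (hx : V ≤ c.U x) (hy : V ≤ c.U y) :
    (SheafOfModules.overFunctor _ V).map (𝟙 A) ≫ w.neg.w x y V hx hy =
      w.w x y V hx hy ≫ (SheafOfModules.overFunctor _ V).map (-𝟙 B) := by
  rw [CategoryTheory.Functor.map_id, Category.id_comp, neg_w, over_map_neg, CategoryTheory.Functor.map_id,
    Preadditive.comp_neg, Category.comp_id]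

end LocalOneCocycle

namespace LocalOneCocycleC

open Literature.AlgebraicGeometry.Modules CocycleTwist

universe u'

variable {X : Scheme.{u'}} {c : UnitCocycle X} {A B : CochainComplex X.Modules ℤ} (w : LocalOneCocycleC c A B)

/-- **The opposite cocycle of complexes `-w`.** [folklore] -/
def neg : LocalOneCocycleC c A B where
  w i := (w.w i).neg
  comm i i' x y V hx hy := by
    rw [LocalOneCocycle.neg_w, LocalOneCocycle.neg_w, Preadditive.comp_neg, Preadditive.neg_comp, w.comm]

/-- Components of the opposite cocycle of complexes. [folklore] -/
@[simp]
theorem neg_w (i : ℤ) : w.neg.w i = (w.w i).neg := rfl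

/-- `(𝟙, -𝟙)` intertwines `w` and `-w` degreewise (the hypothesis of `CocycleExtension.mapC`). [folklore] -/
theorem compat_neg (i : ℤ) (x y : X) (V : X.Opens) (hx : V ≤ c.U x) (hy : V ≤ c.U y) :
    (SheafOfModules.overFunctor _ V).map ((𝟙 A : A ⟶ A).f i) ≫ (w.neg.w i).w x y V hx hy =
      (w.w i).w x y V hx hy ≫ (SheafOfModules.overFunctor _ V).map ((-𝟙 B : B ⟶ B).f i) := by
  rw [HomologicalComplex.id_f, HomologicalComplex.neg_f_apply, HomologicalComplex.id_f]
  exact (w.w i).compat_neg x y V hx hy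

end LocalOneCocycleC

/-! ### The three compatibilities placing `extC (jetWedgeCocycleC)` between the `dlog`-wedge extensions -/

namespace CocycleTwist

open Literature.AlgebraicGeometry.Modules Literature.AlgebraicGeometry.Motives
  Literature.AlgebraicGeometry.HodgeTheory Summit.HodgeConjecture.HodgeConjecture.Theorems.PadicPridhamSemiregularity

universe u

variable {S : Type u} [CommRing S] {X : Over (Spec (CommRingCat.of S))} (c : UnitCocycle X.left) (j : ℕ)
  (L : CochainComplex X.left.Modules ℤ)

/-- **`ι•_j` intertwines `-(dlogWedgeCocycleC (j+1))` with the jet cocycle** (degreewise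
`over_map_twistJetι_comp_jetWedgeHom`; the tree's `dlogWedgeCocycle` is `ψ ↦ ψ ≫ ((-ω) ∧ –)`, so its OPPOSITE is the
sub-component `+ω ∧ –` of the jet cocycle). [folklore] -/
theorem compat_ι_jetWedge (i : ℤ) (x y : X.left) (V : X.left.Opens) (hx : V ≤ c.U x) (hy : V ≤ c.U y) :
    (SheafOfModules.overFunctor _ V).map ((twistJetComplexShortComplex X j L).f.f i) ≫
        ((jetWedgeCocycleC j c L).w i).w x y V hx hy =
      ((dlogWedgeCocycleC c (j + 1) L).neg.w i).w x y V hx hy ≫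
        (SheafOfModules.overFunctor _ V).map ((twistJetComplexShortComplex X (j + 1) L).f.f i) := by
  rw [twistJetComplexShortComplex_f_f, twistJetComplexShortComplex_f_f, jetWedgeCocycleC_w, jetWedgeCocycle_w,
    LocalOneCocycleC.neg_w, LocalOneCocycle.neg_w, dlogWedgeCocycleC_w, dlogWedgeCocycle_w, wedgeHomAt_neg,
    show postcompOver (dual (L.X i)) (-wedgeHomAt (j + 1) (dlogForm c x y V hx hy)) =
        -postcompOver (dual (L.X i)) (wedgeHomAt (j + 1) (dlogForm c x y V hx hy)) from
      hom_ext_of_appLE fun W k ψ => by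
        rw [appLE_postcompOver]
        change _ = -appLE (postcompOver (dual (L.X i)) (wedgeHomAt (j + 1) (dlogForm c x y V hx hy))) k ψ
        rw [appLE_postcompOver]
        change ψ ≫ restrictHom k (-wedgeHomAt (j + 1) (dlogForm c x y V hx hy)) = -(ψ ≫ restrictHom k _)
        rw [show restrictHom k (-wedgeHomAt (j + 1) (dlogForm c x y V hx hy)) =
            -restrictHom k (wedgeHomAt (j + 1) (dlogForm c x y V hx hy)) from hom_ext_of_appLE fun _ _ _ => rfl,
          Preadditive.comp_neg],
    neg_neg]
  exact over_map_twistJetι_comp_jetWedgeHom (L.X i) j (dlogForm c x y V hx hy)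

/-- **`π•_j` intertwines the jet cocycle with `dlogWedgeCocycleC j`** (degreewise
`jetWedgeHom_comp_over_map_twistJetπ`). [folklore] -/
theorem compat_jetWedge_π (i : ℤ) (x y : X.left) (V : X.left.Opens) (hx : V ≤ c.U x) (hy : V ≤ c.U y) :
    (SheafOfModules.overFunctor _ V).map ((twistJetComplexShortComplex X j L).g.f i) ≫
        ((dlogWedgeCocycleC c j L).w i).w x y V hx hy =
      ((jetWedgeCocycleC j c L).w i).w x y V hx hy ≫
        (SheafOfModules.overFunctor _ V).map ((twistJetComplexShortComplex X (j + 1) L).g.f i) := by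
  rw [twistJetComplexShortComplex_g_f, twistJetComplexShortComplex_g_f, jetWedgeCocycleC_w, jetWedgeCocycle_w,
    dlogWedgeCocycleC_w, dlogWedgeCocycle_w]
  exact (jetWedgeHom_comp_over_map_twistJetπ (L.X i) j (dlogForm c x y V hx hy)).symm

end CocycleTwist

end Summit.Ventures.HSemireg

end
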